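import Summits.QuantumFields.YangMills.Theorems.ColdStartUniversalityLatticeLangevinStudentisedCLT
import Mathlib.MeasureTheory.Measure.Portmanteau
import HarnessLib

/-!
# Route `ColdStartUniversality` (fixed-cut-off SZZ dynamics, sampler package): ★★★ ASYMPTOTIC COVERAGE OF THE BATCH-MEANS CONFIDENCE
# INTERVALS — `P[ |√T(Ā_T − μ_(β')G)| ≤ z·σ̂_T ] → N(0,1)([−z, z])` for every `z ≥ 0`, every cold start

Helper file (seat `ym-line-csu-p1`, g35; `--supports stmt-QuantumFields-24809`).  The studentised CLT of file 95b in the form a practitioner uses: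
for every coupling, every realising kernel family, EVERY strong solution of the SU(2) SZZ dynamics from EVERY deterministic start on ANY space,
every continuous `|G| ≤ 1` with `σ²(G) > 0`, every admissible block scheme (`b_n → ∞`, `J_n → ∞`, `b_n/J_n → 0`, `T_n = J_n b_n`) and every
`z ≥ 0`, the probability that the studentised error `|√T_n(Ā_(T_n) − μ_(β')G)/σ̂_n|` is at most `z` — i.e. (when `σ̂_n > 0`) that the interval
`[Ā_(T_n) − zσ̂_n/√T_n, Ā_(T_n) + zσ̂_n/√T_n]` computed from the run COVERS the true Gibbs expectation `μ_(β')(G)` — converges to the standard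
Gaussian mass of `[−z, z]` (★★★ `tendsto_measure_coverage`; e.g. `z = 1.96` ↦ `≈ 0.95`).  Proof: file 95b + the portmanteau theorem (Mathlib
`ProbabilityMeasure.tendsto_measure_of_null_frontier_of_tendsto'`; the frontier `{−z, z}` is Gaussian-null).  THEOREMS ONLY, no definition, no
sorry; [folklore].  HONEST FRAMING: fixed cut-off; asymptotic statement only (no finite-`T` coverage error); `σ²(G)` depends on `L, β'`;
`UniformColdStartMixing` (24809) is NOT restated; no crux, rung or summit statement is proved; the Yang–Mills mass gap is NOT proved.
-/

set_option autoImplicit false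

noncomputable section

namespace Summit.QuantumFields.YangMills.Theorems.ColdStartUniversality

open MeasureTheory ProbabilityTheory Filter Topology Set
open scoped NNReal ENNReal BigOperators
open Literature Literature.Probability.Process Literature.MathematicalPhysics.QuantumFieldTheory
open Literature.MathematicalPhysics.QuantumLattice (fundamentalRep fundamentalLatticeRep continuous_fundamentalRep)

variable {L : ℕ} [NeZero L]

/-- ★★★ **Asymptotic coverage of the batch-means confidence intervals.**  See the module docstring. [folklore] -/
theorem tendsto_measure_coverage (L : ℕ) [NeZero L] (β' : ℝ)
    (κ : ℝ≥0 → Kernel (GaugeConfig 3 L (Matrix.specialUnitaryGroup (Fin 2) ℂ))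
      (GaugeConfig 3 L (Matrix.specialUnitaryGroup (Fin 2) ℂ))) [∀ t, IsMarkovKernel (κ t)]
    (hreal : ∀ (t : ℝ≥0) (x : GaugeConfig 3 L (Matrix.specialUnitaryGroup (Fin 2) ℂ))
        (Ω : Type) [MeasurableSpace Ω] (P : Measure Ω) [IsProbabilityMeasure P]
        (W : ℝ≥0 → Ω → (Edge 3 L × NoiseIdx 2 → ℝ)) (hW : IsFlatBrownian W P)
        (U : ℝ≥0 → Ω → GaugeConfig 3 L (Matrix.specialUnitaryGroup (Fin 2) ℂ)),
        (∀ ω, U 0 ω = x) →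
        (latticeLangevinDynamics (fundamentalLatticeRep 2) β').IsSolution (fundamentalRep (Fin 2))
          hW.natFiltration P W U →
        κ t x = P.map (U t))
    (x : GaugeConfig 3 L (Matrix.specialUnitaryGroup (Fin 2) ℂ))
    {Ω : Type} [MeasurableSpace Ω] {P : Measure Ω} [IsProbabilityMeasure P]
    {W : ℝ≥0 → Ω → (Edge 3 L × NoiseIdx 2 → ℝ)} (hW : IsFlatBrownian W P)
    {U : ℝ≥0 → Ω → GaugeConfig 3 L (Matrix.specialUnitaryGroup (Fin 2) ℂ)} (hU0 : ∀ ω, U 0 ω = x)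
    (hU : (latticeLangevinDynamics (fundamentalLatticeRep 2) β').IsSolution (fundamentalRep (Fin 2)) hW.natFiltration P W U)
    {G : GaugeConfig 3 L (Matrix.specialUnitaryGroup (Fin 2) ℂ) → ℝ} (hGc : Continuous G) (hG1 : ∀ z, |G z| ≤ 1)
    (hσpos : 0 < 2 * ∫ t in Ioi (0 : ℝ),
        (∫ y, (G y - ∫ z, G z ∂(wilsonMeasure (d := 3) (L := L) (fundamentalRep (Fin 2)) β')) *
          (∫ z, (G z - ∫ z', G z' ∂(wilsonMeasure (d := 3) (L := L) (fundamentalRep (Fin 2)) β')) ∂(κ t.toNNReal y))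
          ∂(wilsonMeasure (d := 3) (L := L) (fundamentalRep (Fin 2)) β')))
    (b : ℕ → ℝ) (J : ℕ → ℕ) (hb : ∀ n, 0 < b n) (hJ : ∀ n, 1 ≤ J n)
    (hb_top : Tendsto b atTop atTop) (hJ_top : Tendsto (fun n => (J n : ℝ)) atTop atTop)
    (hbJ : Tendsto (fun n => b n / J n) atTop (𝓝 0)) {z : ℝ} (hz : 0 ≤ z) :
    Tendsto (fun n : ℕ => P {ω |
        |((Real.sqrt ((J n : ℝ) * b n))⁻¹ * ∫ r in Ioc (0 : ℝ) ((J n : ℝ) * b n),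
            (G (U r.toNNReal ω) - ∫ z, G z ∂(wilsonMeasure (d := 3) (L := L) (fundamentalRep (Fin 2)) β'))) /
          Real.sqrt (b n / J n * ∑ j ∈ Finset.range (J n),
            ((∫ r in Ioc ((j : ℝ) * b n) (((j : ℝ) + 1) * b n), G (U r.toNNReal ω)) / b n -
              ((J n : ℝ) * b n)⁻¹ * ∑ j' ∈ Finset.range (J n), ∫ r in Ioc ((j' : ℝ) * b n) (((j' : ℝ) + 1) * b n), G (U r.toNNReal ω)) ^ 2)|
          ≤ z}) atTop (𝓝 (gaussianReal 0 1 (Icc (-z) z))) := by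
  -- the canonical standard Gaussian variable `id` on `(ℝ, gaussianReal 0 1)`
  have hY : HasLaw (fun y : ℝ => y) (gaussianReal 0 1) (gaussianReal 0 1) := ⟨aemeasurable_id, Measure.map_id⟩
  have hclt := studentised_timeAverage_clt L β' κ hreal x hW hU0 hU hGc hG1 hσpos b J hb hJ hb_top hJ_top hbJ ℝ (gaussianReal 0 1)
    (fun y : ℝ => y) hY
  set S : ℕ → Ω → ℝ := fun n ω => ((Real.sqrt ((J n : ℝ) * b n))⁻¹ * ∫ r in Ioc (0 : ℝ) ((J n : ℝ) * b n),
      (G (U r.toNNReal ω) - ∫ z, G z ∂(wilsonMeasure (d := 3) (L := L) (fundamentalRep (Fin 2)) β'))) /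
    Real.sqrt (b n / J n * ∑ j ∈ Finset.range (J n),
      ((∫ r in Ioc ((j : ℝ) * b n) (((j : ℝ) + 1) * b n), G (U r.toNNReal ω)) / b n -
        ((J n : ℝ) * b n)⁻¹ * ∑ j' ∈ Finset.range (J n), ∫ r in Ioc ((j' : ℝ) * b n) (((j' : ℝ) + 1) * b n), G (U r.toNNReal ω)) ^ 2)
    with hS
  have hSm : ∀ n, AEMeasurable (S n) P := hclt.forall_aemeasurable
  -- portmanteau at the Gaussian-null frontier `{−z, z}`
  have hport := ProbabilityMeasure.tendsto_measure_of_null_frontier_of_tendsto' (E := Icc (-z) z) hclt.tendsto (by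
    change ((gaussianReal 0 1).map (fun y : ℝ => y)) (frontier (Icc (-z) z)) = 0
    rw [Measure.map_id', frontier_Icc (by linarith)]
    haveI := nullSingletonClass_gaussianReal (μ := 0) (v := 1) one_ne_zero
    exact (Set.toFinite _).measure_zero _)
  convert hport using 2 with n
  · change P {ω | |S n ω| ≤ z} = (P.map (S n)) (Icc (-z) z)
    rw [Measure.map_apply_of_aemeasurable (hSm n) measurableSet_Icc]
    congr 1
    ext ω
    simp only [Set.mem_preimage, Set.mem_Icc, Set.mem_setOf_eq, abs_le]
  · change gaussianReal 0 1 (Icc (-z) z) = ((gaussianReal 0 1).map (fun y : ℝ => y)) (Icc (-z) z)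
    rw [Measure.map_id']

end Summit.QuantumFields.YangMills.Theorems.ColdStartUniversality

end
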